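import Mathlib.RingTheory.AlgebraicIndependent.AlgebraicClosure
import Literature.NumberTheory.Transcendental.GelfondPowerTowers
import Literature.Barriers.Schanuel.AlgebraicIndependenceOfLogarithms
import Literature.Barriers.Schanuel.NesterenkoModularScope
import HarnessLib

/-!
# Schanuel's conjecture implies Gelfond's power tower conjecture (real bases) — proofs

`Literature/NumberTheory/Transcendental/GelfondPowerTowersProofs.lean` — sibling proofs file of
`Literature/NumberTheory/Transcendental/GelfondPowerTowers.lean`. No new definitions; it
DISCHARGES the named fact `MarquesSondow2012_thm1_real`
(`theorem MarquesSondow2012_thm1_real_holds`): Schanuel's conjecture, in the tree's rank-wise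
format `∀ l, SchanuelRank l`, implies that for every real algebraic irrational `x > 0` and every
`k ≥ 2` the power tower `^k x = (fun y => x ^ y)^[k] 1` is transcendental.

## The printed proof and how it is mirrored (Marques–Sondow 2012, §2 "Proof for z := α", Case 2)

Printed (Case 2, `α ∈ ℚ̄ ∖ ℚ`): "By the Gelfond-Schneider Theorem, `α^α` is transcendental. Hence
`1, α, α^α` are `ℚ`-linearly independent, and then so are `log α, α log α, α^α log α`. … SSC
applied to the subset `{log α, α^α, α^{α^α}} ⊂ {log α, α log α, α^α log α, α, α^α, α^{α^α}}`
yields the algebraic independence of `{log α, ^2α, ^3α}`. Suppose inductively that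
`log α, ^2α, …, ^{m-1}α` are algebraically independent, where `m > 3`. Then any `ℚ`-linear
relation `a₀ + ∑ aⱼ ^jα = 0` implies `a₂ = ⋯ = a_{m-1} = 0`. Since `^1α = α ∉ ℚ`, we also get
`a₀ = a₁ = 0`. That implies the `ℚ`-linear independence of
`{log α, ^1α log α, …, ^{m-1}α log α} = {log α, log(^2α), …, log(^mα)}` … we may apply SSC to the
subset `{log α, ^2α, …, ^mα} ⊂ {log(^1α), …, log(^mα), ^1α, …, ^mα}` and conclude that
`log α, ^2α, …, ^mα` are algebraically independent." (ibid. §1: "SC implies SSC" — under SC,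
`trdeg ℚ(β) = trdeg ℚ(α, e^α) ≥ n` for an `n`-subset `β` on which `{α, e^α}` is `ℚ̄`-dependent.)

Lean rendering, with `L = log x`, `T k = (fun y => x ^ y)^[k] 1` (`T 0 = 1`, `T 1 = x`,
`T (k+1) = x ^ T k = e^{T k · L}`), `w n = (L, T 2, …, T (n+1)) : Fin (n+1) → ℝ` and
`y n = (T 0 · L, …, T n · L) : Fin (n+1) → ℂ`:

* `algebraicIndependent_towers_of_linearIndependent` — the SC/SSC step, uniform in `n`: if `y n`
  is `ℚ`-linearly independent then `SchanuelRank (n+1)` gives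
  `n + 1 ≤ trdeg ℚ(y n, e^{y n}) ≤ trdeg ℚ(w n, x) = trdeg ℚ(w n)` (`e^{yᵢ} = T (i+1)`, `x`
  algebraic), hence `w n` is algebraically independent (the tree's
  `Literature.Barriers.Schanuel.algebraicIndependent_of_le_trdeg_adjoin`,
  `trdeg_adjoin_union_eq_of_isAlgebraic`, `algebraicIndependent_real_of_complex`).
* `linearIndependent_towerLogs_succ` — the printed linear-independence step: algebraic
  independence of `w n` forces every `ℚ`-relation `a₀ + a₁ x + ∑_{j ≥ 2} aⱼ T j = 0` to be trivial.
  The printed "implies `a₂ = ⋯ = a_{m-1} = 0`" silently uses that algebraic independence over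
  `ℚ` persists over `ℚ(α)`; here this is Mathlib's `AlgebraicIndependent.extendScalars`, packaged
  as `eq_zero_of_algebraicIndependent_of_add_sum_smul_eq_zero`.
* `algebraicIndependent_towers_of_schanuel` — the induction on `n`. DEVIATION (shorter road): the
  printed induction starts at `m = 3` from Gelfond–Schneider; we start at `n = 0` (`y 0 = (L)`,
  `L ≠ 0`), so that Schanuel for ranks `1, 2` re-proves the Hermite–Lindemann and
  Gelfond–Schneider inputs and no appeal to `gelfond_schneider_holds` is needed; from `n = 2` on
  the steps are literally the printed ones.
* `MarquesSondow2012_thm1_real_holds` — `T k = w (k-1) (last)` is transcendental for `k ≥ 2`.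

## References

* [MarquesSondow2012] D. Marques, J. Sondow, *The Schanuel Subset Conjecture implies Gelfond's
  Power Tower Conjecture*, arXiv:1212.6931 (2012): §1 (SC ⟹ SSC), Thm 1, §2 Case 2 (lit key
  paper:arxiv-1212.6931, pp. 3–5, read 2026-08-15).
-/

noncomputable section

open Complex IntermediateField

namespace Literature.NumberTheory.Transcendental

/-! ### An algebraic lemma: linear relations with one algebraic coefficient -/

/-- If `v` is algebraically independent over `K`, `c` lies in an intermediate field `F`
algebraic over `K`, and `c + ∑ bᵢ vᵢ = 0` with `bᵢ ∈ K`, then `c = 0` and all `bᵢ = 0`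
(algebraic independence persists over `F`, Mathlib's `AlgebraicIndependent.extendScalars`; the
relation is the degree-`≤ 1` polynomial `C c + ∑ C bᵢ Xᵢ ∈ F[X]`, whose vanishing is read off by
evaluating at `0` and at the coordinate points). [folklore] -/
theorem eq_zero_of_algebraicIndependent_of_add_sum_smul_eq_zero {K E : Type*} [Field K]
    [Field E] [Algebra K E] (F : IntermediateField K E) (hF : Algebra.IsAlgebraic K F)
    {ι : Type*} [Fintype ι] {v : ι → E} (hv : AlgebraicIndependent K v) {c : E} (hc : c ∈ F)
    (b : ι → K) (h : c + ∑ i, b i • v i = 0) : c = 0 ∧ ∀ i, b i = 0 := by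
  classical
  haveI := hF
  have hvF : AlgebraicIndependent F v := hv.extendScalars F
  set P : MvPolynomial ι F :=
    MvPolynomial.C (⟨c, hc⟩ : F) + ∑ i, MvPolynomial.C (algebraMap K F (b i)) * MvPolynomial.X i
    with hP
  have haeval : MvPolynomial.aeval v P = 0 := by
    simp only [hP, map_add, map_sum, map_mul, MvPolynomial.aeval_C, MvPolynomial.aeval_X]
    rw [← h]
    congr 1
    refine Finset.sum_congr rfl fun i _ => ?_
    rw [Algebra.smul_def, ← IsScalarTower.algebraMap_apply]
  have hP0 : P = 0 := (algebraicIndependent_iff.mp hvF) P haeval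
  have hc0 : (⟨c, hc⟩ : F) = 0 := by
    have := congrArg (MvPolynomial.eval (0 : ι → F)) hP0
    simpa [hP] using this
  have hb : ∀ j, b j = 0 := by
    intro j
    have hj := congrArg (MvPolynomial.eval (Pi.single j 1 : ι → F)) hP0
    simp only [hP, map_sum, map_mul, MvPolynomial.eval_C, MvPolynomial.eval_X, hc0,
      zero_add, map_zero, Pi.single_apply, mul_ite, mul_one, mul_zero, Finset.sum_ite_eq',
      Finset.mem_univ, if_true] at hj
    exact (map_eq_zero_iff _ (algebraMap K F).injective).mp hj
  exact ⟨by simpa using congrArg Subtype.val hc0, hb⟩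

/-! ### The towers `T k = (fun y => x ^ y)^[k] 1`: elementary identities -/

/-- `T 0 = 1`. [folklore] -/
theorem tower_zero (x : ℝ) : ((fun y : ℝ => x ^ y)^[0] 1) = 1 := rfl

/-- `T 1 = x`. [folklore] -/
theorem tower_one (x : ℝ) : ((fun y : ℝ => x ^ y)^[1] 1) = x := by
  simp

/-- `T (k+1) = x ^ T k`. [folklore] -/
theorem tower_succ (x : ℝ) (k : ℕ) :
    ((fun y : ℝ => x ^ y)^[k + 1] 1) = x ^ ((fun y : ℝ => x ^ y)^[k] 1) := by
  rw [Function.iterate_succ_apply']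

/-- `e^{T k · log x} = T (k+1)` in `ℂ`, for `x > 0` (`x ^ t = e^{t log x}`). [folklore] -/
theorem cexp_tower_mul_log {x : ℝ} (hx : 0 < x) (k : ℕ) :
    cexp (((((fun y : ℝ => x ^ y)^[k] 1) : ℝ) : ℂ) * ((Real.log x : ℝ) : ℂ)) =
      ((((fun y : ℝ => x ^ y)^[k + 1] 1) : ℝ) : ℂ) := by
  rw [tower_succ, Real.rpow_def_of_pos hx, Complex.ofReal_exp, Complex.ofReal_mul, mul_comm]

/-! ### The Schanuel step (printed: SSC applied to `{log(^1α),…,log(^mα), ^1α,…,^mα}`) -/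

/-- **Schanuel ⟹ algebraic independence of `log x, ^2x, …, ^{n+1}x` from the linear independence
of `log x, x log x, …, ^n x · log x`.** Schanuel for `y = (T i · log x)_{i ≤ n}` gives
`n + 1 ≤ trdeg ℚ(y, e^y)`; since `e^{yᵢ} = T (i+1)` and `T 1 = x` is algebraic, that field lies in
`ℚ(log x, T 2, …, T (n+1), x)`, of transcendence degree that of `ℚ(log x, T 2, …, T (n+1))`; an
`(n+1)`-tuple generating a field of transcendence degree `≥ n+1` is algebraically independent.
This is the SSC step of the printed proof with SC in place of SSC (§1: "SC implies SSC").
[cite: MarquesSondow2012, §2 Case 2 and §1 (SC ⟹ SSC)] -/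
theorem algebraicIndependent_towers_of_linearIndependent (hSC : ∀ l, SchanuelRank l) {x : ℝ}
    (hx : 0 < x) (halg : IsAlgebraic ℚ x) (n : ℕ)
    (hLI : LinearIndependent ℚ (fun i : Fin (n + 1) =>
      ((((fun y : ℝ => x ^ y)^[(i : ℕ)] 1) : ℝ) : ℂ) * ((Real.log x : ℝ) : ℂ))) :
    AlgebraicIndependent ℚ
      (Matrix.vecCons (Real.log x) (fun j : Fin n => ((fun y : ℝ => x ^ y)^[(j : ℕ) + 2] 1))) := by
  have hS := hSC (n + 1) _ hLI
  set w : Fin (n + 1) → ℝ :=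
    Matrix.vecCons (Real.log x) (fun j : Fin n => ((fun y : ℝ => x ^ y)^[(j : ℕ) + 2] 1)) with hw
  set M : IntermediateField ℚ ℂ := adjoin ℚ (Set.range (fun i => (w i : ℂ)) ∪ {(x : ℂ)}) with hM
  have hLmem : ((Real.log x : ℝ) : ℂ) ∈ M :=
    subset_adjoin ℚ _ (Or.inl ⟨0, by simp [hw]⟩)
  have hxmem : (x : ℂ) ∈ M := subset_adjoin ℚ _ (Or.inr rfl)
  -- every tower `T k`, `k ≤ n + 1`, lies in `M = ℚ(w, x)`
  have hTmem : ∀ k, k ≤ n + 1 → ((((fun y : ℝ => x ^ y)^[k] 1) : ℝ) : ℂ) ∈ M := by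
    intro k hk
    match k, hk with
    | 0, _ => simp [tower_zero]
    | 1, _ => rw [tower_one]; exact hxmem
    | j + 2, hj =>
      refine subset_adjoin ℚ _ (Or.inl ⟨(⟨j, by omega⟩ : Fin n).succ, ?_⟩)
      simp [hw]
  -- hence `ℚ(y, e^y) ≤ M`
  have hle : adjoin ℚ (Set.range (fun i : Fin (n + 1) =>
        ((((fun y : ℝ => x ^ y)^[(i : ℕ)] 1) : ℝ) : ℂ) * ((Real.log x : ℝ) : ℂ)) ∪
      Set.range (cexp ∘ (fun i : Fin (n + 1) =>
        ((((fun y : ℝ => x ^ y)^[(i : ℕ)] 1) : ℝ) : ℂ) * ((Real.log x : ℝ) : ℂ)))) ≤ M := by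
    rw [adjoin_le_iff]
    rintro z (⟨i, rfl⟩ | ⟨i, rfl⟩)
    · exact mul_mem (hTmem i (by omega)) hLmem
    · simp only [Function.comp_apply, cexp_tower_mul_log hx]
      exact hTmem (i + 1) (by omega)
  have h1 : ((n + 1 : ℕ) : Cardinal) ≤ Algebra.trdeg ℚ M :=
    hS.trans (trdeg_le_of_injective (IntermediateField.inclusion hle)
      (IntermediateField.inclusion_injective hle))
  -- `x` is algebraic: `trdeg ℚ(w, x) = trdeg ℚ(w)`
  have hunion := Literature.Barriers.Schanuel.trdeg_adjoin_union_eq_of_isAlgebraic (K := ℚ)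
    (Set.range fun i => (w i : ℂ)) {(x : ℂ)}
    (fun z hz => by rw [Set.mem_singleton_iff.mp hz]; exact halg.algebraMap)
  exact Literature.Barriers.Schanuel.algebraicIndependent_real_of_complex _
    (Literature.Barriers.Schanuel.algebraicIndependent_of_le_trdeg_adjoin _ (h1.trans_eq hunion))

/-! ### The linear-independence step (printed: "any ℚ-linear relation … implies a₂ = ⋯ = 0") -/

/-- `log x ≠ 0` for a positive irrational `x` (`x ≠ 1`). [folklore] -/
theorem log_ne_zero_of_irrational {x : ℝ} (hx : 0 < x) (hirr : Irrational x) :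
    Real.log x ≠ 0 :=
  Real.log_ne_zero_of_pos_of_ne_one hx hirr.ne_one

/-- Base of the induction: the one-element family `(T 0 · log x) = (log x)` is `ℚ`-linearly
independent (`log x ≠ 0`). [folklore] -/
theorem linearIndependent_towerLogs_zero {x : ℝ} (hx : 0 < x) (hirr : Irrational x) :
    LinearIndependent ℚ (fun i : Fin 1 =>
      ((((fun y : ℝ => x ^ y)^[(i : ℕ)] 1) : ℝ) : ℂ) * ((Real.log x : ℝ) : ℂ)) := by
  rw [linearIndependent_unique_iff]
  simp [log_ne_zero_of_irrational hx hirr]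

/-- **The linear-independence step.** If `log x, T 2, …, T (n+1)` are algebraically independent
over `ℚ` (with `x > 0` algebraic irrational), then `log x, T 1 · log x, …, T (n+1) · log x` are
`ℚ`-linearly independent: dividing a relation by `log x ≠ 0` gives
`a₀ + a₁ x + ∑_{j ≥ 2} aⱼ T j = 0`; algebraic independence (over `ℚ(x)`,
`eq_zero_of_algebraicIndependent_of_add_sum_smul_eq_zero`) forces `aⱼ = 0` for `j ≥ 2` and
`a₀ + a₁ x = 0`, whence `a₀ = a₁ = 0` as `x ∉ ℚ`.
[cite: MarquesSondow2012, §2 Case 2 (inductive step)] -/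
theorem linearIndependent_towerLogs_succ {x : ℝ} (hx : 0 < x) (halg : IsAlgebraic ℚ x)
    (hirr : Irrational x) (n : ℕ)
    (hAI : AlgebraicIndependent ℚ
      (Matrix.vecCons (Real.log x) (fun j : Fin n => ((fun y : ℝ => x ^ y)^[(j : ℕ) + 2] 1)))) :
    LinearIndependent ℚ (fun i : Fin (n + 1 + 1) =>
      ((((fun y : ℝ => x ^ y)^[(i : ℕ)] 1) : ℝ) : ℂ) * ((Real.log x : ℝ) : ℂ)) := by
  rw [Fintype.linearIndependent_iff]
  intro g hg
  have hL := log_ne_zero_of_irrational hx hirr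
  -- the relation, over `ℝ` and divided by `log x`
  have hR : ∑ i : Fin (n + 1 + 1), (g i : ℝ) * ((fun y : ℝ => x ^ y)^[(i : ℕ)] 1) = 0 := by
    have h1 : (((∑ i : Fin (n + 1 + 1), (g i : ℝ) * ((fun y : ℝ => x ^ y)^[(i : ℕ)] 1) : ℝ) :
        ℂ)) * ((Real.log x : ℝ) : ℂ) = 0 := by
      rw [← hg, Complex.ofReal_sum, Finset.sum_mul]
      refine Finset.sum_congr rfl fun i _ => ?_
      rw [Rat.smul_def]
      push_cast
      ring
    rcases mul_eq_zero.mp h1 with h | h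
    · exact_mod_cast h
    · exact absurd (by exact_mod_cast h) hL
  -- split off the terms `i = 0, 1`: `(g 0 + g 1 x) + ∑_{j < n} g (j+2) T (j+2) = 0`
  have hR' : ((g 0 : ℝ) + (g (Fin.succ 0) : ℝ) * x) +
      ∑ j : Fin n, (g j.succ.succ : ℝ) * ((fun y : ℝ => x ^ y)^[(j : ℕ) + 2] 1) = 0 := by
    have e : ∀ j : Fin n,
        ((fun y : ℝ => x ^ y)^[(j : ℕ) + 1 + 1] 1) = ((fun y : ℝ => x ^ y)^[(j : ℕ) + 2] 1) :=
      fun j => rfl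
    rw [Fin.sum_univ_succ, Fin.sum_univ_succ] at hR
    simp only [Fin.val_zero, Function.iterate_zero, id_eq, mul_one, Fin.val_succ,
      Function.iterate_one, Real.rpow_one, zero_add, e] at hR
    linarith [hR]
  -- the algebraic coefficient `g 0 + g 1 x ∈ ℚ(x)`, `ℚ(x)/ℚ` algebraic
  have hF : Algebra.IsAlgebraic ℚ (adjoin ℚ {x} : IntermediateField ℚ ℝ) :=
    isAlgebraic_adjoin_simple halg.isIntegral
  have hmem : (g 0 : ℝ) + (g (Fin.succ 0) : ℝ) * x ∈ (adjoin ℚ {x} : IntermediateField ℚ ℝ) :=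
    add_mem (algebraMap_mem _ _) (mul_mem (algebraMap_mem _ _)
      (subset_adjoin ℚ _ (Set.mem_singleton x)))
  have key := eq_zero_of_algebraicIndependent_of_add_sum_smul_eq_zero (adjoin ℚ {x}) hF hAI
    hmem (Matrix.vecCons 0 (fun j : Fin n => g j.succ.succ)) (by
      rw [← hR', Fin.sum_univ_succ]
      simp only [Matrix.cons_val_zero, zero_smul, zero_add, Matrix.cons_val_succ, Rat.smul_def])
  obtain ⟨hc, hb⟩ := key
  -- `g 0 + g 1 x = 0` with `x ∉ ℚ`
  have h1 : g (Fin.succ 0) = 0 := by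
    by_contra h1
    have h1R : (g (Fin.succ 0) : ℝ) ≠ 0 := by exact_mod_cast h1
    refine hirr.ne_rat (-(g 0) / g (Fin.succ 0)) ?_
    push_cast
    field_simp
    linarith
  have h0 : g 0 = 0 := by
    rw [h1, Rat.cast_zero, zero_mul, add_zero] at hc
    exact_mod_cast hc
  intro i
  refine Fin.cases h0 (fun i => ?_) i
  refine Fin.cases h1 (fun j => ?_) i
  simpa using hb j.succ

/-! ### The induction and the theorem -/

/-- **Schanuel ⟹ `log x, ^2x, ^3x, …, ^{n+1}x` are algebraically independent** for every real
algebraic irrational `x > 0` and every `n` (induction on `n`: the Schanuel step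
`algebraicIndependent_towers_of_linearIndependent` alternating with the linear-independence step
`linearIndependent_towerLogs_succ`; base `n = 0`: `log x ≠ 0`). This is the
algebraic-independence conclusion of the printed Case 2 ("`log α, ^2α, ^3α, …, ^mα` are
algebraically independent"), under SC. [cite: MarquesSondow2012, Thm 1 and §2 Case 2] -/
theorem algebraicIndependent_towers_of_schanuel (hSC : ∀ l, SchanuelRank l) {x : ℝ}
    (hx : 0 < x) (halg : IsAlgebraic ℚ x) (hirr : Irrational x) (n : ℕ) :
    AlgebraicIndependent ℚ
      (Matrix.vecCons (Real.log x) (fun j : Fin n => ((fun y : ℝ => x ^ y)^[(j : ℕ) + 2] 1))) := by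
  induction n with
  | zero =>
    exact algebraicIndependent_towers_of_linearIndependent hSC hx halg 0
      (linearIndependent_towerLogs_zero hx hirr)
  | succ n ih =>
    exact algebraicIndependent_towers_of_linearIndependent hSC hx halg (n + 1)
      (linearIndependent_towerLogs_succ hx halg hirr n ih)

/-- **Marques–Sondow 2012, Theorem 1 (real algebraic irrational base, transcendence clause),
from Schanuel's conjecture** — DISCHARGE of the named fact `MarquesSondow2012_thm1_real`:
assuming `∀ l, SchanuelRank l` (= `Literature.Periods.SchanuelConjecture`), for every real
algebraic irrational `x > 0` and every `k ≥ 2` the power tower `(fun y => x ^ y)^[k] 1` is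
transcendental ("Assume the Schanuel Subset Conjecture. Then Gelfond's Power Tower Conjecture is
also true"; §1: "SC implies SSC"). Proof: `^k x` is a member of the algebraically independent
family of `algebraicIndependent_towers_of_schanuel` with `n = k - 1`.
[cite: MarquesSondow2012, Thm 1 with §1 (SC ⟹ SSC); proof §2, Case 2] -/
theorem MarquesSondow2012_thm1_real_holds : MarquesSondow2012_thm1_real := by
  intro hSC x hx halg hirr k hk
  obtain ⟨j, rfl⟩ : ∃ j, k = j + 2 := ⟨k - 2, by omega⟩
  have hAI := algebraicIndependent_towers_of_schanuel hSC hx halg hirr (j + 1)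
  have ht := hAI.transcendental (⟨j, by omega⟩ : Fin (j + 1)).succ
  simpa using ht

end Literature.NumberTheory.Transcendental

end
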